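import Summits.BirchSwinnertonDyer.Rank1Residual.O5.FullLocalThreeTorsionMuThree
import Literature.NumberTheory.EllipticCurves.ReductionHomomorphismCuspNodeProofs
import HarnessLib

/-!
# Full local `3`-torsion at a BAD prime `ℓ ≠ 3` forces `3 ∣ c_ℓ`: such a prime is `3`-transverse
# (cell `b2b-bsdres`, lane CLASS-CLOSURE, class O5; harvest seat 2, GEN 57, E113; sequel to E112)

HONEST FRAMING (cell `b2b-bsdres`, run/shared/lean/b2b/bsd-rank1-residual/, verbatim in every
file): the goal of the cell is to DELETE the COMBINATION-SHAPED residual classes of the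
Birch–Swinnerton-Dyer formula for ALL analytic-rank `≤ 1` elliptic curves over `ℚ` — "full BSD
formula for every rank `≤ 1` curve in class `C`" assembled STRICTLY from published theorems — so
that the rank-`≤ 1` remainder becomes exactly the CONSTRUCTION-SHAPED classes, which are TYPED
(missing-input `Prop`s), NOT attempted. This is not "finishing BSD". Lane CLASS-CLOSURE: research
routes; no claim beyond the stated classes; census output is EVIDENCE, never a Literature fact;
nothing is booked here; no mark of `RESIDUAL-MAP.md` moves; O5 stays OPEN. THEOREMS ONLY (no
definition, no named fact, no `@[conjecture]` node, no `sorry`; net named-fact debt `0`); no node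
file and no vocabulary file is touched.

## What this file does

The census predicate `FullLocalThreeTorsionAt W ℓ` (`O5/O5UncleanParity.lean`, "`h⁰(ℚ_ℓ, W[3]) = 2`")
carries in its docstring the sentence "For `ℓ ≠ 3` this forces `ℓ ≡ 1 (mod 3)` and good or split
multiplicative reduction with `3 ∣ v_ℓ(Δ)` (Thm 7 (d)); census: 1 419 incidences, all of that
shape." E112 (`O5/FullLocalThreeTorsionMuThree.lean`) proved the first clause (`ℓ ≡ 1 (mod 3)`, Weil
pairing). This file proves the second: **at a prime `ℓ ≠ 3` of BAD reduction, full local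
`3`-torsion forces `3 ∣ c_ℓ`** — so the prime is `3`-TRANSVERSE (`KunduRay2024.PDvdTamagawaAt W 3 ℓ`,
the currency of `transversePrimesThree`). (That additive primes `ℓ ≠ 3` never carry full local
`3`-torsion, and that a bad such prime is therefore SPLIT multiplicative with `3 ∣ v_ℓ(Δ_min) = c_ℓ`
— a non-split `c_ℓ` being `1` or `2` — is the sequel E114, `O5/FullLocalThreeTorsionSplit.lean`.)

* §0 group theory: `mem_of_three_nsmul_eq_zero_of_not_dvd_index` — `3`-torsion lies in any
  subgroup of index prime to `3` (Bézout); `exists_pair_three_nsmul_of_addEquiv` (transport).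
* §1 **`not_exists_pair_three_nsmul_of_node`** — for an integral `I/ℤ_q`, `q ≠ 3`, reducing to a
  NODE (`Δ̄ = 0`, `c̄₄ ≠ 0`) with `3 ∤ [E(ℚ_q) : E₀(ℚ_q)]`: no two `ℚ_q`-points of order `3` with
  `Q ≠ ±P`. Both points lie in `E₀(ℚ_q)` (§0); the node homomorphism `r : E₀(ℚ_q) → k̄ˣ` with kernel
  `E₁(ℚ_q)` (Silverman *AEC* VII.2.1 + III.2.5; tree `exists_addMonoidHom_units_of_node`,
  `ReductionHomomorphismCuspNodeProofs.lean`) is injective on `3`-torsion since `E₁(ℚ_q)` has none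
  (`3 ∈ ℤ_q^×`, *AEC* VII.3.1 (a); tree `CuspDivision.eq_zero_of_nsmul_eq_zero_of_reducesToZero`,
  x11b3-p4), so the nine values `r(aP + bQ)` (distinct by E112's `pair_nsmul_injective`) would be
  nine cube roots of unity in the FIELD `k̄` — `X³ − 1` has at most three
  (Mathlib `Polynomial.card_nthRoots`).
* §2 `residue_Δ_eq_zero_and_residue_c₄_ne_zero_of_hasMultiplicativeReduction` (Mathlib's
  `HasMultiplicativeReduction` read on the integral model: a node; after x11b3's cusp version),
  **`not_exists_pair_three_nsmul_of_mult` / `not_fullLocalThreeTorsionAt_of_mult_of_not_three_dvd`**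
  — for `W/ℚ` elliptic, a MULTIPLICATIVE prime `q ≠ 3` (`Mult W q`) with `3 ∤ c_q`:
  `¬ FullLocalThreeTorsionAt W q` (§1 on the chosen `ℤ_q`-minimal model `C • (W ⊗ ℚ_q) = I ⊗ ℚ_q`,
  whose `E₀`-index is `c_q` — the E110 §1 template —, transported along
  `VariableChange.pointEquiv`, then E111's `exists_pair_three_nsmul_iff_fullLocalThreeTorsionAt`);
  `pDvdTamagawaAt_three_of_fullLocalThreeTorsionAt_of_mult` (contrapositive, census currency).
* §3 `pDvdTamagawaAt_three_of_fullLocalThreeTorsionAt_of_addv` (ADDITIVE `q ≠ 3`: E111 §4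
  `pDvdTamagawaAt_three_iff_not_noLocalThreeTorsionAt` — a pair is in particular one non-zero
  `3`-torsion point), **`pDvdTamagawaAt_three_of_fullLocalThreeTorsionAt_of_not_good`** — at a BAD
  prime `q ≠ 3`, `FullLocalThreeTorsionAt W q → PDvdTamagawaAt W 3 q` —, and the census form
  `not_fullLocalThreeTorsionAt_of_not_good_of_not_pDvdTamagawaAt` (`h⁰ ≤ 1` at every non-transverse
  bad prime `≠ 3`).

With E112: a prime `ℓ ≠ 3` with `h⁰(ℚ_ℓ, W[3]) = 2` is `≡ 1 (mod 3)` and is good or `3`-transverse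
(the sequel E114 sharpens "bad and `3`-transverse" to "split multiplicative with `3 ∣ v_ℓ(Δ_min)`").
Nothing about any particular curve is asserted; the census count stays EVIDENCE; no node is
discharged.

References: J. H. Silverman, *The Arithmetic of Elliptic Curves*, 2nd ed. (2009), III.2.5,
VII.2 Prop. 2.1, VII.3 Prop. 3.1 (a), VII.5 Prop. 5.1, Thm. VII.6.1 (Kodaira–Néron)
[SilvermanAEC2009]; *Advanced Topics* (1994), IV.9 Remark 9.2.2 [SilvermanATAEC1994]; cell:
`O5/O5UncleanParity.lean` §1 (o5-r1 T25 / cc-typer-5), `O5/FullLocalThreeTorsionMuThree.lean`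
(E112), `O5/NoLocalThreeTorsionTransport.lean` (E111), `O5/AdditiveTamagawaThreeInvariantHolds.lean`
(E110), `Additive/AdditiveReductionPrimeToPDivisible.lean` (x11b3-p4 `CuspDivision`),
`X11b/Three/MultiplicativeMinimalBaseChange.lean` (x11b3 valuation dictionary),
HOME/b2b-bsdres-harvest-2/gen57/E113.

## Design

No definitions; `noncomputable section`; `open scoped Classical`. Axioms of every declaration:
`propext`, `Classical.choice`, `Quot.sound`.
-/

set_option autoImplicit false

noncomputable section

open scoped Classical

namespace Summit.BirchSwinnertonDyer.Rank1Residual.O5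

open WeierstrassCurve Polynomial Literature.NumberTheory.EllipticCurves
  Literature.NumberTheory.EllipticCurves.Rank1Residual
  Summit.BirchSwinnertonDyer.Rank1Residual.Additive

universe u

/-! ## §0 Group theory: `3`-torsion lies in a subgroup of index prime to `3` -/

/-- If `[A : H]` is finite and prime to `3`, every `x ∈ A` with `3•x = 0` lies in `H`
(Bézout: `x = u•([A:H]•x) + v•(3•x)`). [folklore] -/
theorem mem_of_three_nsmul_eq_zero_of_not_dvd_index {A : Type*} [AddCommGroup A]
    (H : AddSubgroup A) (h3 : ¬ 3 ∣ H.index) {x : A} (hx : 3 • x = 0) : x ∈ H := by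
  have hcop : Nat.Coprime H.index 3 :=
    Nat.Coprime.symm ((Nat.Prime.coprime_iff_not_dvd Nat.prime_three).mpr h3)
  obtain ⟨u, v, huv⟩ := Nat.isCoprime_iff_coprime.mpr hcop
  have hmem : (H.index : ℤ) • x ∈ H := by
    rw [natCast_zsmul]; exact H.nsmul_index_mem x
  have hx' : ((3 : ℕ) : ℤ) • x = 0 := by rw [natCast_zsmul, hx]
  have : x = u • ((H.index : ℤ) • x) + v • (((3 : ℕ) : ℤ) • x) := by
    rw [smul_smul, smul_smul, ← add_smul, huv, one_smul]
  rw [this, hx', smul_zero, add_zero]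
  exact H.zsmul_mem hmem u

/-- Transport of "two independent `3`-torsion points" along an additive isomorphism. [folklore] -/
theorem exists_pair_three_nsmul_of_addEquiv {A B : Type*} [AddCommGroup A] [AddCommGroup B]
    (e : A ≃+ B) (h : ∃ P Q : A, P ≠ 0 ∧ Q ≠ 0 ∧ 3 • P = 0 ∧ 3 • Q = 0 ∧ Q ≠ P ∧ Q ≠ -P) :
    ∃ P Q : B, P ≠ 0 ∧ Q ≠ 0 ∧ 3 • P = 0 ∧ 3 • Q = 0 ∧ Q ≠ P ∧ Q ≠ -P := by
  obtain ⟨P, Q, hP0, hQ0, hP3, hQ3, hQP, hQnP⟩ := h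
  refine ⟨e P, e Q, (e.map_ne_zero_iff).mpr hP0, (e.map_ne_zero_iff).mpr hQ0,
    by rw [← map_nsmul, hP3, map_zero], by rw [← map_nsmul, hQ3, map_zero],
    fun h0 ↦ hQP (e.injective h0), fun h0 ↦ hQnP (e.injective ?_)⟩
  rw [map_neg]; exact h0

/-! ## §1 At a NODE over `ℤ_q` (`q ≠ 3`): no pair of independent `3`-torsion points when
`3 ∤ [E(ℚ_q) : E₀(ℚ_q)]` -/

section Node

variable (q : ℕ) [hq : Fact q.Prime]

/-- **At a node with `3 ∤ [E(ℚ_q) : E₀(ℚ_q)]` (`q ≠ 3`) there is no pair of `ℚ_q`-points of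
order `3` with `Q ≠ ±P`.** For an integral equation `I/ℤ_q` whose reduction is a node
(`Δ̄ = 0`, `c̄₄ ≠ 0`) and whose subgroup `E₀(ℚ_q)` of points of nonsingular reduction has index
prime to `3`: two such points `P, Q` lie in `E₀(ℚ_q)` (§0); the node homomorphism
`r : E₀(ℚ_q) → k̄ˣ` with kernel `E₁(ℚ_q)` (Silverman *AEC* VII.2.1 + III.2.5, tree
`exists_addMonoidHom_units_of_node`) is injective on `3`-torsion because `E₁(ℚ_q)` has none
(`3 ∈ ℤ_q^×`, *AEC* VII.3.1 (a), tree `CuspDivision.eq_zero_of_nsmul_eq_zero_of_reducesToZero`),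
so the nine values `r(aP + bQ)` would be nine distinct cube roots of unity in the field `k̄` —
but `X³ − 1` has at most three roots (Mathlib `Polynomial.card_nthRoots`).
[cite: SilvermanAEC2009, VII.2 Prop. 2.1, VII.3 Prop. 3.1 (a), III.2.5]
[cite: SilvermanATAEC1994, IV.9 Remark 9.2.2] -/
theorem not_exists_pair_three_nsmul_of_node (hq3 : q ≠ 3) (I : WeierstrassCurve ℤ_[q])
    [(I.baseChange ℚ_[q]).IsElliptic]
    (hΔ : IsLocalRing.residue ℤ_[q] I.Δ = 0) (hc₄ : IsLocalRing.residue ℤ_[q] I.c₄ ≠ 0)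
    (h3 : ¬ 3 ∣ (I.nonsingularReductionSubgroup
      (integers_valuationRing_valuation ℤ_[q] ℚ_[q])).index) :
    ¬ ∃ P Q : (I.baseChange ℚ_[q]).toAffine.Point,
        P ≠ 0 ∧ Q ≠ 0 ∧ 3 • P = 0 ∧ 3 • Q = 0 ∧ Q ≠ P ∧ Q ≠ -P := by
  rintro ⟨P, Q, hP0, hQ0, hP3, hQ3, hQP, hQnP⟩
  set hv := integers_valuationRing_valuation ℤ_[q] ℚ_[q] with hvdef
  set H := I.nonsingularReductionSubgroup hv with hHdef
  have hu : IsUnit ((3 : ℕ) : ℤ_[q]) := isUnit_three_padicInt q hq3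
  -- both points lie in `E₀(ℚ_q)`
  have hPH : P ∈ H := mem_of_three_nsmul_eq_zero_of_not_dvd_index H h3 hP3
  have hQH : Q ∈ H := mem_of_three_nsmul_eq_zero_of_not_dvd_index H h3 hQ3
  -- the node homomorphism `r : E₀(ℚ_q) → k̄ˣ`, kernel `E₁(ℚ_q)`
  obtain ⟨r, hr⟩ := I.exists_addMonoidHom_units_of_node hv hΔ hc₄
  -- `r` is injective on the `3`-torsion of `E₀(ℚ_q)`
  have hker : ∀ x : H, 3 • x = 0 → r x = 0 → x = 0 := fun x hx hrx ↦ by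
    have hred : I.ReducesToZero (x : (I.baseChange ℚ_[q]).toAffine.Point) := (hr x).mp hrx
    have hx' : 3 • (x : (I.baseChange ℚ_[q]).toAffine.Point) = 0 := by
      rw [← AddSubmonoidClass.coe_nsmul, hx]; rfl
    exact Subtype.ext (CuspDivision.eq_zero_of_nsmul_eq_zero_of_reducesToZero ℤ_[q] I hu hred hx')
  set P' : H := ⟨P, hPH⟩ with hP'def
  set Q' : H := ⟨Q, hQH⟩ with hQ'def
  have hP'3 : 3 • P' = 0 := Subtype.ext (by rw [AddSubmonoidClass.coe_nsmul]; exact hP3)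
  have hQ'3 : 3 • Q' = 0 := Subtype.ext (by rw [AddSubmonoidClass.coe_nsmul]; exact hQ3)
  -- the images `p = r P'`, `q' = r Q'` in `Additive k̄ˣ`
  have hp3 : 3 • r P' = 0 := by rw [← map_nsmul, hP'3, map_zero]
  have hq3' : 3 • r Q' = 0 := by rw [← map_nsmul, hQ'3, map_zero]
  have hp0 : r P' ≠ 0 := fun h0 ↦ hP0 (by
    have := hker P' hP'3 h0
    exact congrArg Subtype.val this)
  have hq0 : r Q' ≠ 0 := fun h0 ↦ hQ0 (by
    have := hker Q' hQ'3 h0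
    exact congrArg Subtype.val this)
  have hqp : r Q' ≠ r P' := fun h0 ↦ hQP (by
    have h1 : r (Q' - P') = 0 := by rw [map_sub, h0, sub_self]
    have h2 : 3 • (Q' - P') = 0 := by rw [nsmul_sub, hP'3, hQ'3, sub_zero]
    have := hker _ h2 h1
    exact congrArg Subtype.val (sub_eq_zero.mp this))
  have hqnp : r Q' ≠ -r P' := fun h0 ↦ hQnP (by
    have h1 : r (Q' + P') = 0 := by rw [map_add, h0, neg_add_cancel]
    have h2 : 3 • (Q' + P') = 0 := by rw [nsmul_add, hP'3, hQ'3, add_zero]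
    have := hker _ h2 h1
    have h4 : Q' = -P' := eq_neg_of_add_eq_zero_left this
    exact congrArg Subtype.val h4)
  -- nine distinct elements of `Additive k̄ˣ` killed by `3`
  have hinj := pair_nsmul_injective hp3 hq3' hp0 hq0 hqp hqnp
  set kb := AlgebraicClosure (IsLocalRing.ResidueField ℤ_[q])
  set g : Fin 3 × Fin 3 → kb :=
    fun ab ↦ ((Additive.toMul ((ab.1 : ℕ) • r P' + (ab.2 : ℕ) • r Q') : kbˣ) : kb) with hgdef
  have hginj : Function.Injective g := fun ab cd h ↦ hinj (by
    have h1 := Units.ext h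
    exact Additive.toMul.injective h1)
  have hroot : ∀ ab, g ab ∈ (Polynomial.nthRoots 3 (1 : kb)).toFinset := fun ab ↦ by
    rw [Multiset.mem_toFinset, Polynomial.mem_nthRoots three_pos, hgdef]
    simp only
    rw [← Units.val_pow_eq_pow_val, ← toMul_nsmul, nsmul_add, smul_comm 3 (ab.1 : ℕ) (r P'),
      smul_comm 3 (ab.2 : ℕ) (r Q'), hp3, hq3', smul_zero, smul_zero, add_zero, toMul_zero,
      Units.val_one]
  have hcard9 : (Finset.univ.image g).card = 9 := by
    rw [Finset.card_image_of_injective _ hginj]; simp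
  have hsub : Finset.univ.image g ⊆ (Polynomial.nthRoots 3 (1 : kb)).toFinset := by
    intro x hx
    obtain ⟨ab, -, rfl⟩ := Finset.mem_image.mp hx
    exact hroot ab
  have hle3 : ((Polynomial.nthRoots 3 (1 : kb)).toFinset).card ≤ 3 :=
    (Multiset.toFinset_card_le _).trans (Polynomial.card_nthRoots 3 1)
  have := Finset.card_le_card hsub
  omega

end Node

/-! ## §2 Multiplicative reduction of `W/ℚ` at `q`: the `ℤ_q`-minimal model reduces to a node -/

section Mult

variable (W : WeierstrassCurve ℚ) [W.IsElliptic] (q : ℕ) [hq : Fact q.Prime]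

/-- For an integral equation `I/ℤ_q` whose generic fibre has MULTIPLICATIVE reduction (Mathlib's
`HasMultiplicativeReduction`: `v(Δ) < 1`, `v(c₄) = 1` on the integral model) the reduction is a
node: `Δ̄ = 0`, `c̄₄ ≠ 0`. [cite: SilvermanAEC2009, VII.5 Prop. 5.1 (b)] -/
theorem residue_Δ_eq_zero_and_residue_c₄_ne_zero_of_hasMultiplicativeReduction
    (I : WeierstrassCurve ℤ_[q]) [h : (I.baseChange ℚ_[q]).HasMultiplicativeReduction ℤ_[q]] :
    IsLocalRing.residue ℤ_[q] I.Δ = 0 ∧ IsLocalRing.residue ℤ_[q] I.c₄ ≠ 0 := by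
  haveI : (I.baseChange ℚ_[q]).IsIntegral ℤ_[q] := ⟨I, rfl⟩
  have hI : (I.baseChange ℚ_[q]).integralModel ℤ_[q] = I :=
    integralModel_eq_of_baseChange_eq (I.baseChange ℚ_[q]) I rfl
  have hΔ := h.badReduction
  have hc := h.multiplicativeReduction
  rw [← integralModel_Δ_eq ℤ_[q] (I.baseChange ℚ_[q]), hI,
    X11b.Three.JetchevKummer.valuation_algebraMap_lt_one_iff_not_isUnit] at hΔ
  rw [← integralModel_c₄_eq ℤ_[q] (I.baseChange ℚ_[q]), hI,
    X11b.Three.JetchevKummer.valuation_algebraMap_eq_one_iff_isUnit] at hc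
  refine ⟨(IsLocalRing.residue_eq_zero_iff _).mpr ((IsLocalRing.mem_maximalIdeal _).mpr hΔ),
    fun h0 ↦ ?_⟩
  rw [IsLocalRing.residue_eq_zero_iff, IsLocalRing.mem_maximalIdeal] at h0
  exact h0 hc

/-- **At a MULTIPLICATIVE prime `q ≠ 3` of `W/ℚ` with `3 ∤ c_q`: no pair of `ℚ_q`-points of order
`3` with `Q ≠ ±P`** (§1 on the chosen `ℤ_q`-minimal model `C • (W ⊗ ℚ_q) = I ⊗ ℚ_q`, whose
`E₀`-index is `c_q`; transport along `VariableChange.pointEquiv`).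
[cite: SilvermanAEC2009, VII.2 Prop. 2.1, VII.3 Prop. 3.1 (a), Thm. VII.6.1]
[cite: SilvermanATAEC1994, IV.9 Remark 9.2.2] -/
theorem not_exists_pair_three_nsmul_of_mult (hq3 : q ≠ 3) (hmult : Mult W q)
    (h3 : ¬ 3 ∣ (W.baseChange ℚ_[q]).localTamagawaNumber ℤ_[q]) :
    ¬ ∃ P Q : (W.baseChange ℚ_[q]).toAffine.Point,
        P ≠ 0 ∧ Q ≠ 0 ∧ 3 • P = 0 ∧ 3 • Q = 0 ∧ Q ≠ P ∧ Q ≠ -P := by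
  haveI : Finite (IsLocalRing.ResidueField ℤ_[q]) :=
    Finite.of_equiv (ZMod q) (PadicInt.residueField (p := q)).symm.toEquiv
  -- the chosen `ℤ_[q]`-minimal model `M = C • (W ⊗ ℚ_q) = I ⊗ ℚ_q` has multiplicative reduction
  haveI hM : ((W.baseChange ℚ_[q]).minimal ℤ_[q]).HasMultiplicativeReduction ℤ_[q] := hmult
  obtain ⟨C, hC⟩ : ∃ C : VariableChange ℚ_[q],
      (W.baseChange ℚ_[q]).minimal ℤ_[q] = C • W.baseChange ℚ_[q] := ⟨_, rfl⟩
  obtain ⟨I, hI⟩ : ∃ I : WeierstrassCurve ℤ_[q],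
      (W.baseChange ℚ_[q]).minimal ℤ_[q] = I.baseChange ℚ_[q] := IsIntegral.integral
  haveI hImult : (I.baseChange ℚ_[q]).HasMultiplicativeReduction ℤ_[q] := hI ▸ hM
  haveI : (I.baseChange ℚ_[q]).IsElliptic := by rw [← hI, hC]; infer_instance
  obtain ⟨hΔ, hc₄⟩ := residue_Δ_eq_zero_and_residue_c₄_ne_zero_of_hasMultiplicativeReduction q I
  -- `c_q` is the index of `E₀(ℚ_q)` of `I`
  have hc : (W.baseChange ℚ_[q]).localTamagawaNumber ℤ_[q] =
      (I.nonsingularReductionSubgroup (integers_valuationRing_valuation ℤ_[q] ℚ_[q])).index := by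
    change (((W.baseChange ℚ_[q]).minimal ℤ_[q]).goodReductionSubgroup ℤ_[q]).index = _
    rw [index_goodReductionSubgroup_congr_of_eq hI, goodReductionSubgroup_baseChange_eq]
  rw [hc] at h3
  -- transport of the pair along `W ⊗ ℚ_q ≃ C • (W ⊗ ℚ_q) = I ⊗ ℚ_q`
  have e : (W.baseChange ℚ_[q]).toAffine.Point ≃+ (I.baseChange ℚ_[q]).toAffine.Point :=
    (VariableChange.pointEquiv (W.baseChange ℚ_[q]) C).trans
      (Affine.Point.congrEquiv (hC.symm.trans hI))
  intro h
  exact not_exists_pair_three_nsmul_of_node q hq3 I hΔ hc₄ h3 (exists_pair_three_nsmul_of_addEquiv e h)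

/-- **`¬ FullLocalThreeTorsionAt W q` at a multiplicative prime `q ≠ 3` with `3 ∤ c_q`**
(`h⁰(ℚ_q, W[3]) ≤ 1` there). [cite: SilvermanAEC2009, VII.2 Prop. 2.1, VII.3 Prop. 3.1 (a), Thm. VII.6.1] -/
theorem not_fullLocalThreeTorsionAt_of_mult_of_not_three_dvd (hq3 : q ≠ 3) (hmult : Mult W q)
    (h3 : ¬ 3 ∣ (W.baseChange ℚ_[q]).localTamagawaNumber ℤ_[q]) :
    ¬ FullLocalThreeTorsionAt W q := fun h ↦
  not_exists_pair_three_nsmul_of_mult W q hq3 hmult h3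
    ((exists_pair_three_nsmul_iff_fullLocalThreeTorsionAt W q).mpr h)

/-- **Full local `3`-torsion at a MULTIPLICATIVE prime `q ≠ 3` forces `3 ∣ c_q`** (in the tree's
census currency `KunduRay2024.PDvdTamagawaAt W 3 q`; since a non-split `c_q` is `1` or `2`, the
prime is then split multiplicative with `3 ∣ v_q(Δ_min) = c_q` — the second clause of "Thm 7 (d)" in
the docstring of `FullLocalThreeTorsionAt`, `O5/O5UncleanParity.lean`; that last step is carried
out in the sequel E114).
[cite: SilvermanAEC2009, Thm. VII.6.1 (Kodaira–Néron)] -/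
theorem pDvdTamagawaAt_three_of_fullLocalThreeTorsionAt_of_mult (hq3 : q ≠ 3) (hmult : Mult W q)
    (h : FullLocalThreeTorsionAt W q) : KunduRay2024.PDvdTamagawaAt W 3 q := by
  by_contra h3
  refine not_fullLocalThreeTorsionAt_of_mult_of_not_three_dvd W q hq3 hmult (fun hd ↦ h3 ?_) h
  exact ⟨hq, hd⟩

end Mult

/-! ## §3 Additive primes (E111 §4) and the bad-prime statement -/

section Bad

variable (W : WeierstrassCurve ℚ) [W.IsElliptic] (q : ℕ) [hq : Fact q.Prime]

/-- **Full local `3`-torsion at an ADDITIVE prime `q ≠ 3` forces `3 ∣ c_q`** — immediate from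
E111 §4 (`PDvdTamagawaAt W 3 q ↔ ¬ NoLocalThreeTorsionAt W q` at additive `q ≠ 3`): a pair of
order-`3` points is in particular one non-zero `3`-torsion point. (In fact `h⁰ ≤ 1` at every
additive `q ≠ 3`, since `W(ℚ_q)[3] ↪ Φ_q(𝔽_q)` has order `≤ c_q ≤ 4`, so the hypothesis is never
met: proved in the sequel E114, `not_fullLocalThreeTorsionAt_of_addv`; not needed here.)
[cite: SilvermanATAEC1994, IV.9 Remark 9.2.2] -/
theorem pDvdTamagawaAt_three_of_fullLocalThreeTorsionAt_of_addv (hq3 : q ≠ 3) (hadd : Addv W q)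
    (h : FullLocalThreeTorsionAt W q) : KunduRay2024.PDvdTamagawaAt W 3 q := by
  rw [pDvdTamagawaAt_three_iff_not_noLocalThreeTorsionAt W q hq3 hadd,
    ← exists_ne_zero_three_nsmul_iff_not_noLocalThreeTorsionAt W q]
  obtain ⟨P, Q, hP0, -, hP3, -⟩ := (exists_pair_three_nsmul_iff_fullLocalThreeTorsionAt W q).mpr h
  exact ⟨P, hP0, hP3⟩

/-- **"Thm 7 (d)", bad-prime half: full local `3`-torsion at a prime `q ≠ 3` of BAD reduction
forces `3 ∣ c_q`, i.e. `q` is a `3`-TRANSVERSE prime of `W`** (additive: E111 §4; multiplicative: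
§2). Together with E112 (`q ≡ 1 (mod 3)`): a prime `ℓ ≠ 3` with `h⁰(ℚ_ℓ, W[3]) = 2` is
`≡ 1 (mod 3)` and either good or bad and `3`-transverse; the sequel E114
(`O5/FullLocalThreeTorsionSplit.lean`: additive excluded, non-split excluded) turns this into the
full sentence "for `ℓ ≠ 3` this forces `ℓ ≡ 1 (mod 3)` and good or split multiplicative reduction
with `3 ∣ v_ℓ(Δ)`" of the docstring of `FullLocalThreeTorsionAt` (`O5/O5UncleanParity.lean`;
census: 1 419 incidences, all of that shape). [cite: SilvermanAEC2009, Thm. VII.6.1 (Kodaira–Néron)]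
[cite: SilvermanATAEC1994, IV.9 Remark 9.2.2] -/
theorem pDvdTamagawaAt_three_of_fullLocalThreeTorsionAt_of_not_good (hq3 : q ≠ 3)
    (hbad : ¬ W.HasGoodReductionAtPrime q) (h : FullLocalThreeTorsionAt W q) :
    KunduRay2024.PDvdTamagawaAt W 3 q := by
  by_cases hmult : Mult W q
  · exact pDvdTamagawaAt_three_of_fullLocalThreeTorsionAt_of_mult W q hq3 hmult h
  · exact pDvdTamagawaAt_three_of_fullLocalThreeTorsionAt_of_addv W q hq3 ⟨hbad, hmult⟩ h

/-- Contrapositive, census form: **at a bad prime `q ≠ 3` with `3 ∤ c_q` (a NON-transverse bad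
prime) `h⁰(ℚ_q, W[3]) ≤ 1`.** [cite: SilvermanAEC2009, Thm. VII.6.1 (Kodaira–Néron)] -/
theorem not_fullLocalThreeTorsionAt_of_not_good_of_not_pDvdTamagawaAt (hq3 : q ≠ 3)
    (hbad : ¬ W.HasGoodReductionAtPrime q) (h3 : ¬ KunduRay2024.PDvdTamagawaAt W 3 q) :
    ¬ FullLocalThreeTorsionAt W q := fun h ↦
  h3 (pDvdTamagawaAt_three_of_fullLocalThreeTorsionAt_of_not_good W q hq3 hbad h)

end Bad

end Summit.BirchSwinnertonDyer.Rank1Residual.O5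

end
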